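import Literature.Analysis.FluidPDE.LeiZhang2011MoserLevel
import Literature.Analysis.FluidPDE.LeiZhang2011MoserChain
import Literature.Analysis.FluidPDE.LeiZhang2011StreamL6
import HarnessLib

/-!
# Lei–Zhang 2011, §2: the mean value inequality (2.6) for the swirl-type equation

Analysis/FluidPDE proofs file (theorems only), on the discharge path of the named fact
`Literature.Analysis.FluidPDE.LeiZhang2011_liouville` (Z. Lei, Q. S. Zhang, J. Funct. Anal. 261
(2011) = arXiv:1011.5066, §2 (2.6): "`sup_{P(R/2)} |Γ| ≲ K(‖b‖_E)^5 {R^{-5} ∬_{P(R)} |Γ|³}^{1/3}`").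
Combining the discharged Moser step `reverse_holder_between_cylinders` (one level), the
arithmetic of its constant along the chain of radii `r_k = (ρ/2)(1 + 3^{-k})`
(`moser_level_constant_le`) and the abstract chain `eLpNorm_top_cylinder_le_of_reverse_holder`,
we obtain the mean value inequality in the tree's form: for every `BMO` bound `C_B` there is
`C = C(C_B)` such that for every radius `ρ > 0`, every solution in the setting at radius `ρ`
and every admissible power family `H_m = w^m` (`w = |·|` or `w = (c − ·)₊`, …),

`‖w(F)‖_{L^∞(Q(ρ/2))} ≤ C ρ^{-5/4} ‖w(F)‖_{L⁴(Q(ρ))}`, `Q(r) = (−r², 0] × B̄(0, r)`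

(`LeiZhang2011.meanValue_inequality`; the exponent `4` replaces the paper's `3`, any `p₀ > 3`
being admissible for the start of the chain above `L²`, and `ρ^{-5/4} = ρ^{-5/p₀}`).

## References

* Z. Lei, Q. S. Zhang, J. Funct. Anal. 261 (2011) = arXiv:1011.5066, §2 (2.5)–(2.6), p. 8.
  [LeiZhang2011]
-/

noncomputable section

open MeasureTheory Set Function Filter Metric intervalIntegral
open _root_.Topology
open scoped InnerProductSpace RealInnerProductSpace NNReal ENNReal Laplacian

namespace Literature.Analysis.FluidPDE

namespace LeiZhang2011

open Literature.Analysis.FunctionSpaces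

/-- **The constant of the Moser step along the chain of radii.** With `r₁ = (ρ/2)(1 + 3^{-k})`,
`r₂ = (ρ/2)(1 + 3^{-(k+1)})`, `κ ≤ 2`, cut-off constants `C_φ`, `C_T ≥ 0`, `C_J ≥ 0`, and the
volumes of the balls of radius `r₁` bounded by `ρ³ V₁`, the constant of `reverse_holder_step`
is at most `c · ρ^{-5/9} · 27^{(10/9) k}` with
`c = (5/2) C_S² V₁^{5/9} (8C_φ² + C_T + 8 C_φ² C_J C_B²)^{5/3} 9^{5/3}`. [folklore] -/
theorem moser_level_constant_le (k : ℕ) {ρ : ℝ} (hρ : 0 < ρ) {CS Cφ CT CJ CB V₁ κ Vc Vb r₁ r₂ : ℝ}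
    (hCT : 0 ≤ CT) (hCJ : 0 ≤ CJ) (hV₁ : 0 ≤ V₁) (hκ0 : 0 ≤ κ) (hκ2 : κ ≤ 2)
    (hVc0 : 0 ≤ Vc) (hVc : Vc ≤ ρ ^ 3 * V₁) (hVb0 : 0 ≤ Vb) (hVb : Vb ≤ ρ ^ 3 * V₁)
    (hr₁ : r₁ = ρ / 2 * (1 + (1 / 3 : ℝ) ^ k)) (hr₂ : r₂ = ρ / 2 * (1 + (1 / 3 : ℝ) ^ (k + 1))) :
    (5 / 2) * CS ^ 2 *
        (((4 * κ * (Cφ / (r₁ - r₂)) ^ 2 + CT / (r₁ ^ 2 - r₂ ^ 2)) * Vc ^ (1 / (3 : ℝ)) +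
            4 * κ * (Cφ / (r₁ - r₂)) ^ 2 * CJ * CB ^ 2 * Vb ^ (1 / (3 : ℝ))) *
          (r₁ ^ 2) ^ (1 / (3 : ℝ))) ^ (5 / 3 : ℝ) ≤
      ((5 / 2) * CS ^ 2 * V₁ ^ (5 / 9 : ℝ) * (8 * Cφ ^ 2 + CT + 8 * Cφ ^ 2 * CJ * CB ^ 2) ^ (5 / 3 : ℝ) *
          (9 : ℝ) ^ (5 / 3 : ℝ)) * ρ ^ (-(5 / 9 : ℝ)) * (27 : ℝ) ^ ((10 / 9 : ℝ) * k) := by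
  -- `t = 3^{k+1}`
  set t : ℝ := (3 : ℝ) ^ (k + 1) with ht
  have ht0 : 0 < t := by positivity
  have ht1 : 1 ≤ t := one_le_pow₀ (by norm_num)
  have h13 : (1 / 3 : ℝ) ^ (k + 1) = t⁻¹ := by rw [ht, ← inv_pow]; norm_num
  have hdiff : r₁ - r₂ = ρ * t⁻¹ := by
    rw [hr₁, hr₂, ← h13, pow_succ]; ring
  have hr₁ρ : r₁ ≤ ρ := by
    rw [hr₁]
    have : (1 / 3 : ℝ) ^ k ≤ 1 := pow_le_one₀ (by norm_num) (by norm_num)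
    nlinarith
  have hr₂0 : 0 < r₂ := by rw [hr₂]; positivity
  have hr₁0 : 0 < r₁ := by rw [hr₁]; positivity
  have hsum : ρ ≤ r₁ + r₂ := by
    rw [hr₁, hr₂]
    have h1 : 0 ≤ (1 / 3 : ℝ) ^ k := by positivity
    have h2 : 0 ≤ (1 / 3 : ℝ) ^ (k + 1) := by positivity
    nlinarith
  have hrr : 0 < r₁ ^ 2 - r₂ ^ 2 := by
    rw [show r₁ ^ 2 - r₂ ^ 2 = (r₁ - r₂) * (r₁ + r₂) by ring, hdiff]
    exact mul_pos (by positivity) (by linarith)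
  -- `D² = C_φ² t² / ρ²`
  have hD2 : (Cφ / (r₁ - r₂)) ^ 2 = Cφ ^ 2 * t ^ 2 / ρ ^ 2 := by
    rw [hdiff]; field_simp
  -- `D' ≤ C_T t² / ρ²`
  have hD' : CT / (r₁ ^ 2 - r₂ ^ 2) ≤ CT * t ^ 2 / ρ ^ 2 := by
    have hden : ρ ^ 2 * t⁻¹ ≤ r₁ ^ 2 - r₂ ^ 2 := by
      rw [show r₁ ^ 2 - r₂ ^ 2 = (r₁ - r₂) * (r₁ + r₂) by ring, hdiff]
      have : 0 ≤ ρ * t⁻¹ := by positivity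
      nlinarith
    have hden0 : 0 < ρ ^ 2 * t⁻¹ := by positivity
    calc CT / (r₁ ^ 2 - r₂ ^ 2) ≤ CT / (ρ ^ 2 * t⁻¹) := div_le_div_of_nonneg_left hCT hden0 hden
      _ = CT * t / ρ ^ 2 := by rw [div_mul_eq_div_div, div_inv_eq_mul]; ring
      _ ≤ CT * t ^ 2 / ρ ^ 2 := by
          refine div_le_div_of_nonneg_right ?_ (by positivity)
          nlinarith [mul_nonneg hCT ht0.le]
  -- volume and time factors
  have hV13 : ∀ {V : ℝ}, 0 ≤ V → V ≤ ρ ^ 3 * V₁ → V ^ (1 / (3 : ℝ)) ≤ ρ * V₁ ^ (1 / (3 : ℝ)) := by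
    intro V hV0 hV
    calc V ^ (1 / (3 : ℝ)) ≤ (ρ ^ 3 * V₁) ^ (1 / (3 : ℝ)) := Real.rpow_le_rpow hV0 hV (by norm_num)
      _ = ρ * V₁ ^ (1 / (3 : ℝ)) := by
          rw [Real.mul_rpow (by positivity) hV₁, ← Real.rpow_natCast ρ 3, ← Real.rpow_mul hρ.le]
          norm_num
  have hT : (r₁ ^ 2) ^ (1 / (3 : ℝ)) ≤ ρ ^ (2 / (3 : ℝ)) := by
    calc (r₁ ^ 2) ^ (1 / (3 : ℝ)) ≤ (ρ ^ 2) ^ (1 / (3 : ℝ)) :=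
          Real.rpow_le_rpow (sq_nonneg _) (pow_le_pow_left₀ hr₁0.le hr₁ρ 2) (by norm_num)
      _ = ρ ^ (2 / (3 : ℝ)) := by rw [← Real.rpow_natCast ρ 2, ← Real.rpow_mul hρ.le]; norm_num
  -- the base of the power
  set Λ₀ : ℝ := 8 * Cφ ^ 2 + CT + 8 * Cφ ^ 2 * CJ * CB ^ 2 with hΛ₀
  have hΛ₀0 : 0 ≤ Λ₀ := by positivity
  have hbase : ((4 * κ * (Cφ / (r₁ - r₂)) ^ 2 + CT / (r₁ ^ 2 - r₂ ^ 2)) * Vc ^ (1 / (3 : ℝ)) +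
        4 * κ * (Cφ / (r₁ - r₂)) ^ 2 * CJ * CB ^ 2 * Vb ^ (1 / (3 : ℝ))) * (r₁ ^ 2) ^ (1 / (3 : ℝ)) ≤
      t ^ 2 * ρ ^ (-(1 / 3 : ℝ)) * V₁ ^ (1 / (3 : ℝ)) * Λ₀ := by
    rw [hD2]
    have hVc' := hV13 hVc0 hVc
    have hVb' := hV13 hVb0 hVb
    have hA : 4 * κ * (Cφ ^ 2 * t ^ 2 / ρ ^ 2) + CT / (r₁ ^ 2 - r₂ ^ 2) ≤ (8 * Cφ ^ 2 + CT) * t ^ 2 / ρ ^ 2 := by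
      have : 4 * κ * (Cφ ^ 2 * t ^ 2 / ρ ^ 2) ≤ 8 * (Cφ ^ 2 * t ^ 2 / ρ ^ 2) :=
        mul_le_mul_of_nonneg_right (by linarith) (by positivity)
      have e : (8 * Cφ ^ 2 + CT) * t ^ 2 / ρ ^ 2 = 8 * (Cφ ^ 2 * t ^ 2 / ρ ^ 2) + CT * t ^ 2 / ρ ^ 2 := by ring
      rw [e]; linarith
    have hA0 : 0 ≤ 4 * κ * (Cφ ^ 2 * t ^ 2 / ρ ^ 2) + CT / (r₁ ^ 2 - r₂ ^ 2) :=
      add_nonneg (by positivity) (div_nonneg hCT hrr.le)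
    have hB : 4 * κ * (Cφ ^ 2 * t ^ 2 / ρ ^ 2) * CJ * CB ^ 2 ≤ 8 * Cφ ^ 2 * CJ * CB ^ 2 * t ^ 2 / ρ ^ 2 := by
      have : 4 * κ ≤ 8 := by linarith
      have h0 : 0 ≤ Cφ ^ 2 * t ^ 2 / ρ ^ 2 * CJ * CB ^ 2 := by positivity
      calc 4 * κ * (Cφ ^ 2 * t ^ 2 / ρ ^ 2) * CJ * CB ^ 2 = 4 * κ * (Cφ ^ 2 * t ^ 2 / ρ ^ 2 * CJ * CB ^ 2) := by ring
        _ ≤ 8 * (Cφ ^ 2 * t ^ 2 / ρ ^ 2 * CJ * CB ^ 2) := mul_le_mul_of_nonneg_right this h0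
        _ = 8 * Cφ ^ 2 * CJ * CB ^ 2 * t ^ 2 / ρ ^ 2 := by ring
    have hB0 : 0 ≤ 4 * κ * (Cφ ^ 2 * t ^ 2 / ρ ^ 2) * CJ * CB ^ 2 := by positivity
    have hV₁3 : 0 ≤ V₁ ^ (1 / (3 : ℝ)) := Real.rpow_nonneg hV₁ _
    have hinner : (4 * κ * (Cφ ^ 2 * t ^ 2 / ρ ^ 2) + CT / (r₁ ^ 2 - r₂ ^ 2)) * Vc ^ (1 / (3 : ℝ)) +
        4 * κ * (Cφ ^ 2 * t ^ 2 / ρ ^ 2) * CJ * CB ^ 2 * Vb ^ (1 / (3 : ℝ)) ≤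
        ((8 * Cφ ^ 2 + CT) * t ^ 2 / ρ ^ 2) * (ρ * V₁ ^ (1 / (3 : ℝ))) +
          (8 * Cφ ^ 2 * CJ * CB ^ 2 * t ^ 2 / ρ ^ 2) * (ρ * V₁ ^ (1 / (3 : ℝ))) :=
      add_le_add (mul_le_mul hA hVc' (Real.rpow_nonneg hVc0 _) (hA0.trans hA))
        (mul_le_mul hB hVb' (Real.rpow_nonneg hVb0 _) (hB0.trans hB))
    have hinner0 : 0 ≤ (4 * κ * (Cφ ^ 2 * t ^ 2 / ρ ^ 2) + CT / (r₁ ^ 2 - r₂ ^ 2)) * Vc ^ (1 / (3 : ℝ)) +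
        4 * κ * (Cφ ^ 2 * t ^ 2 / ρ ^ 2) * CJ * CB ^ 2 * Vb ^ (1 / (3 : ℝ)) :=
      add_nonneg (mul_nonneg hA0 (Real.rpow_nonneg hVc0 _)) (mul_nonneg hB0 (Real.rpow_nonneg hVb0 _))
    calc _ ≤ (((8 * Cφ ^ 2 + CT) * t ^ 2 / ρ ^ 2) * (ρ * V₁ ^ (1 / (3 : ℝ))) +
          (8 * Cφ ^ 2 * CJ * CB ^ 2 * t ^ 2 / ρ ^ 2) * (ρ * V₁ ^ (1 / (3 : ℝ)))) * ρ ^ (2 / (3 : ℝ)) :=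
          mul_le_mul hinner hT (Real.rpow_nonneg (sq_nonneg _) _) (hinner0.trans hinner)
      _ = t ^ 2 * V₁ ^ (1 / (3 : ℝ)) * Λ₀ * (ρ⁻¹ * ρ ^ (2 / (3 : ℝ))) := by
          simp only [hΛ₀]; field_simp
      _ = t ^ 2 * ρ ^ (-(1 / 3 : ℝ)) * V₁ ^ (1 / (3 : ℝ)) * Λ₀ := by
          have : ρ⁻¹ * ρ ^ (2 / (3 : ℝ)) = ρ ^ (-(1 / 3 : ℝ)) := by
            rw [← Real.rpow_neg_one, ← Real.rpow_add hρ]; norm_num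
          rw [this]; ring
  -- raise to the power `5/3`
  have hbase0 : 0 ≤ ((4 * κ * (Cφ / (r₁ - r₂)) ^ 2 + CT / (r₁ ^ 2 - r₂ ^ 2)) * Vc ^ (1 / (3 : ℝ)) +
        4 * κ * (Cφ / (r₁ - r₂)) ^ 2 * CJ * CB ^ 2 * Vb ^ (1 / (3 : ℝ))) * (r₁ ^ 2) ^ (1 / (3 : ℝ)) := by
    refine mul_nonneg (add_nonneg (mul_nonneg (add_nonneg (by positivity) (div_nonneg hCT hrr.le))
      (Real.rpow_nonneg hVc0 _)) (by positivity)) (Real.rpow_nonneg (sq_nonneg _) _)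
  have hpow : (((4 * κ * (Cφ / (r₁ - r₂)) ^ 2 + CT / (r₁ ^ 2 - r₂ ^ 2)) * Vc ^ (1 / (3 : ℝ)) +
        4 * κ * (Cφ / (r₁ - r₂)) ^ 2 * CJ * CB ^ 2 * Vb ^ (1 / (3 : ℝ))) * (r₁ ^ 2) ^ (1 / (3 : ℝ))) ^ (5 / 3 : ℝ) ≤
      t ^ (10 / 3 : ℝ) * ρ ^ (-(5 / 9 : ℝ)) * V₁ ^ (5 / 9 : ℝ) * Λ₀ ^ (5 / 3 : ℝ) := by
    calc _ ≤ (t ^ 2 * ρ ^ (-(1 / 3 : ℝ)) * V₁ ^ (1 / (3 : ℝ)) * Λ₀) ^ (5 / 3 : ℝ) :=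
          Real.rpow_le_rpow hbase0 hbase (by norm_num)
      _ = t ^ (10 / 3 : ℝ) * ρ ^ (-(5 / 9 : ℝ)) * V₁ ^ (5 / 9 : ℝ) * Λ₀ ^ (5 / 3 : ℝ) := by
          rw [Real.mul_rpow (by positivity) hΛ₀0, Real.mul_rpow (by positivity) (Real.rpow_nonneg hV₁ _),
            Real.mul_rpow (by positivity) (Real.rpow_nonneg hρ.le _), ← Real.rpow_natCast t 2,
            ← Real.rpow_mul ht0.le, ← Real.rpow_mul hρ.le, ← Real.rpow_mul hV₁]
          norm_num
  -- `t^{10/3} = 9^{5/3} 27^{(10/9) k}`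
  have htpow : t ^ (10 / 3 : ℝ) = (9 : ℝ) ^ (5 / 3 : ℝ) * (27 : ℝ) ^ ((10 / 9 : ℝ) * k) := by
    rw [ht, ← Real.rpow_natCast (3 : ℝ) (k + 1), ← Real.rpow_mul (by norm_num),
      show (9 : ℝ) = 3 ^ (2 : ℝ) by norm_num, show (27 : ℝ) = 3 ^ (3 : ℝ) by norm_num,
      ← Real.rpow_mul (by norm_num), ← Real.rpow_mul (by norm_num), ← Real.rpow_add (by norm_num)]
    congr 1
    push_cast
    ring
  rw [htpow] at hpow
  have hCS : 0 ≤ 5 / 2 * CS ^ 2 := by positivity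
  calc 5 / 2 * CS ^ 2 * (((4 * κ * (Cφ / (r₁ - r₂)) ^ 2 + CT / (r₁ ^ 2 - r₂ ^ 2)) * Vc ^ (1 / (3 : ℝ)) +
          4 * κ * (Cφ / (r₁ - r₂)) ^ 2 * CJ * CB ^ 2 * Vb ^ (1 / (3 : ℝ))) * (r₁ ^ 2) ^ (1 / (3 : ℝ))) ^ (5 / 3 : ℝ)
      ≤ 5 / 2 * CS ^ 2 * ((9 : ℝ) ^ (5 / 3 : ℝ) * (27 : ℝ) ^ ((10 / 9 : ℝ) * k) * ρ ^ (-(5 / 9 : ℝ)) *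
          V₁ ^ (5 / 9 : ℝ) * Λ₀ ^ (5 / 3 : ℝ)) := mul_le_mul_of_nonneg_left hpow hCS
    _ = _ := by ring

/-- Volumes of the balls of the Moser chain: `|B̄(0,r)| = |B(0,r)| = r³ |B(0,1)| ≤ ρ³ |B(0,1)|` for
`0 < r ≤ ρ`. [folklore] -/
theorem volumeReal_ball_le {r ρ : ℝ} (hr : 0 < r) (hrρ : r ≤ ρ) :
    0 ≤ volume.real (closedBall (0 : EuclideanSpace ℝ (Fin 3)) r) ∧
    volume.real (closedBall (0 : EuclideanSpace ℝ (Fin 3)) r) ≤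
      ρ ^ 3 * volume.real (ball (0 : EuclideanSpace ℝ (Fin 3)) 1) ∧
    0 ≤ volume.real (ball (0 : EuclideanSpace ℝ (Fin 3)) r) ∧
    volume.real (ball (0 : EuclideanSpace ℝ (Fin 3)) r) ≤
      ρ ^ 3 * volume.real (ball (0 : EuclideanSpace ℝ (Fin 3)) 1) := by
  have h1 : volume.real (closedBall (0 : EuclideanSpace ℝ (Fin 3)) r) =
      r ^ 3 * volume.real (ball (0 : EuclideanSpace ℝ (Fin 3)) 1) := by
    rw [Measure.addHaar_real_closedBall _ _ hr.le, finrank_euclideanSpace_fin]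
  have h2 : volume.real (ball (0 : EuclideanSpace ℝ (Fin 3)) r) =
      volume.real (closedBall (0 : EuclideanSpace ℝ (Fin 3)) r) :=
    (Measure.addHaar_real_closedBall_eq_addHaar_real_ball _ _ _).symm
  have hV : 0 ≤ volume.real (ball (0 : EuclideanSpace ℝ (Fin 3)) 1) := measureReal_nonneg
  have hr3 : r ^ 3 ≤ ρ ^ 3 := pow_le_pow_left₀ hr.le hrρ 3
  refine ⟨measureReal_nonneg, ?_, measureReal_nonneg, ?_⟩
  · rw [h1]; exact mul_le_mul_of_nonneg_right hr3 hV
  · rw [h2, h1]; exact mul_le_mul_of_nonneg_right hr3 hV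

/-- **The mean value inequality (Lei–Zhang 2011, (2.6)) for the swirl-type equation with a
`BMO` stream function.** For every bound `C_B` of the `BMO` seminorm there is a constant
`C ≥ 0` such that: for every radius `ρ > 0`, every solution `F` in the setting at radius `ρ`
(hypotheses as in `reverse_holder_between_cylinders`), and every admissible power family
`H_m = w^m`, `m > 2` (`H_m ∈ C²`, `H_m(0) = 0`, `H_m'' ≥ 0`, `H_m'² ≤ (m/(m−1)) H_m H_m''`, with
`C¹` square roots `s_m`, `s_m² = H_m`, `2 s_m'² ≤ H_m''`), the quantity `u = w(F)` satisfies
`‖u‖_{L^∞((−ρ²/4,0]×B̄(0,ρ/2))} ≤ C ρ^{-5/4} ‖u‖_{L⁴((−ρ²,0]×B̄(0,ρ))}`. [cite: LeiZhang2011, §2 (2.6) (arXiv p. 8), the local maximum estimate] -/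
theorem meanValue_inequality (CB : ℝ≥0) :
    ∃ Cmv : ℝ, 0 ≤ Cmv ∧ ∀ ⦃ρ : ℝ⦄, 0 < ρ →
      ∀ ⦃F N : ℝ → EuclideanSpace ℝ (Fin 3) → ℝ⦄
        ⦃b Bst : ℝ → EuclideanSpace ℝ (Fin 3) → EuclideanSpace ℝ (Fin 3)⦄,
      (∀ s, ContDiff ℝ 2 (F s)) → (∀ s, IsAxisymmetricScalar (F s)) →
      (∀ s x, cylRadius x = 0 → F s x = 0) →
      (∀ s, LocallyIntegrable (b s) volume) →
      (∀ᵐ s ∂(volume.restrict (Ioc (-ρ ^ 2) 0)),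
        Differentiable ℝ (Bst s) ∧ curl (Bst s) =ᵐ[volume] b s ∧ eBMOSeminormVec (Bst s) ≤ CB) →
      (∀ s x, N s x =
        (Δ (F s)) x - fderiv ℝ (F s) x (b s x) - 2 / cylRadius x * fderiv ℝ (F s) x (eR x)) →
      (∀ᵐ x ∂(volume : Measure (EuclideanSpace ℝ (Fin 3))),
        IntervalIntegrable (fun s => N s x) volume (-ρ ^ 2) 0 ∧
          ∀ s ∈ Icc (-ρ ^ 2) 0, F s x = F (-ρ ^ 2) x + ∫ τ in (-ρ ^ 2)..s, N τ x) →
      (Continuous fun p : ℝ × EuclideanSpace ℝ (Fin 3) => F p.1 p.2) →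
      (Continuous fun p : ℝ × EuclideanSpace ℝ (Fin 3) => gradient (F p.1) p.2) →
      AEStronglyMeasurable (fun p : ℝ × EuclideanSpace ℝ (Fin 3) => N p.1 p.2)
        ((volume.restrict (Ioc (-ρ ^ 2) 0)).prod volume) →
      Integrable (fun p : ℝ × EuclideanSpace ℝ (Fin 3) => N p.1 p.2)
        ((volume.restrict (Ioc (-ρ ^ 2) 0)).prod (volume.restrict (closedBall 0 ρ))) →
      AEStronglyMeasurable (fun p : ℝ × EuclideanSpace ℝ (Fin 3) => b p.1 p.2)
        ((volume.restrict (Ioc (-ρ ^ 2) 0)).prod volume) →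
      ∀ ⦃Mb : ℝ⦄, (∀ s, ∀ x ∈ closedBall (0 : EuclideanSpace ℝ (Fin 3)) ρ, ‖b s x‖ ≤ Mb) →
      ∀ ⦃w : ℝ → ℝ⦄, (∀ v, 0 ≤ w v) → Continuous w →
      ∀ ⦃Hf sf : ℝ → ℝ → ℝ⦄, (∀ m v, 2 < m → Hf m v = w v ^ m) →
      (∀ m, 2 < m → ContDiff ℝ 2 (Hf m) ∧ Hf m 0 = 0 ∧ (∀ v, 0 ≤ deriv (deriv (Hf m)) v) ∧
        (∀ v, deriv (Hf m) v ^ 2 ≤ m / (m - 1) * (Hf m v * deriv (deriv (Hf m)) v)) ∧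
        ContDiff ℝ 1 (sf m) ∧ (∀ v, sf m v ^ 2 = Hf m v) ∧
        (∀ v, 2 * deriv (sf m) v ^ 2 ≤ deriv (deriv (Hf m)) v)) →
      eLpNorm (fun p : ℝ × EuclideanSpace ℝ (Fin 3) => w (F p.1 p.2)) ∞
          (((volume : Measure ℝ).prod (volume : Measure (EuclideanSpace ℝ (Fin 3)))).restrict
            (Ioc (-(ρ / 2) ^ 2) 0 ×ˢ closedBall (0 : EuclideanSpace ℝ (Fin 3)) (ρ / 2))) ≤
        ENNReal.ofReal (Cmv * ρ ^ (-(5 / 4 : ℝ))) *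
          eLpNorm (fun p : ℝ × EuclideanSpace ℝ (Fin 3) => w (F p.1 p.2)) (ENNReal.ofReal 4)
            (((volume : Measure ℝ).prod (volume : Measure (EuclideanSpace ℝ (Fin 3)))).restrict
              (Ioc (-ρ ^ 2) 0 ×ˢ closedBall (0 : EuclideanSpace ℝ (Fin 3)) ρ)) := by
  -- the absolute constants
  obtain ⟨Cφ, hCφ0, hCφ⟩ := exists_norm_gradient_radialCutoff_le
  obtain ⟨CT, hCT0, hCT⟩ := exists_abs_deriv_smoothTransition_le
  obtain ⟨CJ, hCJ0, hCJ⟩ := exists_setIntegral_norm_sub_sq_cube_le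
  set CS : ℝ := (SNormLESNormFDerivOfEqConst ℝ (volume : Measure (EuclideanSpace ℝ (Fin 3))) 2 : ℝ) with hCS
  set V₁ : ℝ := volume.real (ball (0 : EuclideanSpace ℝ (Fin 3)) 1) with hV₁
  have hV₁0 : 0 ≤ V₁ := measureReal_nonneg
  set c₁ : ℝ := (5 / 2) * CS ^ 2 * V₁ ^ (5 / 9 : ℝ) * (8 * Cφ ^ 2 + CT + 8 * Cφ ^ 2 * CJ * (CB : ℝ) ^ 2) ^ (5 / 3 : ℝ) *
    (9 : ℝ) ^ (5 / 3 : ℝ) with hc₁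
  have hc₁0 : 0 ≤ c₁ := by positivity
  set c₁' : ℝ := c₁ + 1 with hc₁'
  have hc₁'0 : 0 < c₁' := by positivity
  refine ⟨c₁' ^ (9 / 4 : ℝ) * (27 : ℝ) ^ (45 / 2 : ℝ), by positivity, ?_⟩
  intro ρ hρ F N b Bst hF2 hFa hF0 hb hBst hN heq hFc hF1c hNm hNi hbm Mb hbB w hw0 hwc Hf sf hHw hfam
  -- the chain constants
  set C₀r : ℝ := (c₁' * ρ ^ (-(5 / 9 : ℝ))) ^ (9 / 10 : ℝ) with hC₀r
  have hC₀r0 : 0 < C₀r := by positivity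
  set C₀ : ℝ≥0 := Real.toNNReal C₀r with hC₀
  have hC₀ne : C₀ ≠ 0 := fun h => (not_le.2 hC₀r0) (Real.toNNReal_eq_zero.1 h)
  have hC₀e : ((C₀ : ℝ≥0∞)) = ENNReal.ofReal C₀r := rfl
  have hu : AEStronglyMeasurable (fun p : ℝ × EuclideanSpace ℝ (Fin 3) => w (F p.1 p.2))
      ((volume : Measure ℝ).prod (volume : Measure (EuclideanSpace ℝ (Fin 3)))) :=
    (hwc.comp hFc).aestronglyMeasurable
  have hchain := eLpNorm_top_cylinder_le_of_reverse_holder hu (fun p => hw0 _) hρ hC₀ne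
    (b := 27) (by norm_num) ?_
  · refine hchain.trans (le_of_eq ?_)
    congr 1
    -- `C₀^{5/2} 27^{45/2} = ofReal (c₁'^{9/4} 27^{45/2} ρ^{-5/4})`
    rw [hC₀e, ENNReal.ofReal_rpow_of_nonneg hC₀r0.le (by norm_num),
      show ((27 : ℝ≥0) : ℝ≥0∞) = ENNReal.ofReal 27 by norm_num,
      ENNReal.ofReal_rpow_of_nonneg (by norm_num) (by norm_num), ← ENNReal.ofReal_mul (by positivity)]
    congr 1
    rw [hC₀r, ← Real.rpow_mul (by positivity), Real.mul_rpow hc₁'0.le (Real.rpow_nonneg hρ.le _),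
      ← Real.rpow_mul hρ.le]
    norm_num
    ring
  -- ### the reverse Hölder inequality at level `k`
  intro k
  obtain ⟨hrk0, hrklo, hrkhi⟩ := moser_radius_bounds hρ k
  obtain ⟨hrk10, hrk1lo, hrk1hi⟩ := moser_radius_bounds hρ (k + 1)
  set r₁ : ℝ := ρ / 2 * (1 + (1 / 3 : ℝ) ^ k) with hr₁
  set r₂ : ℝ := ρ / 2 * (1 + (1 / 3 : ℝ) ^ (k + 1)) with hr₂
  have hr : r₂ < r₁ := by
    rw [hr₁, hr₂, pow_succ]
    have : 0 < (1 / 3 : ℝ) ^ k := by positivity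
    nlinarith
  -- the exponent `m = (8/3)(10/9)^k > 2`
  set m : ℝ := 8 / 3 * (10 / 9 : ℝ) ^ k with hm
  have hmk : (1 : ℝ) ≤ (10 / 9 : ℝ) ^ k := one_le_pow₀ (by norm_num)
  have hm2 : 2 < m := by rw [hm]; nlinarith
  obtain ⟨hH, hH00, hH2, hκ', hsH, hsH2, hsH'⟩ := hfam m hm2
  have hH0 : ∀ v, 0 ≤ Hf m v := fun v => by rw [hHw m v hm2]; exact Real.rpow_nonneg (hw0 v) _
  set κ : ℝ := m / (m - 1) with hκdef
  have hm1 : 0 < m - 1 := by linarith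
  have hκ1 : 1 ≤ κ := by rw [hκdef, le_div_iff₀ hm1]; linarith
  have hκ2 : κ ≤ 2 := by rw [hκdef, div_le_iff₀ hm1]; linarith
  have hκ : ∀ v, deriv (Hf m) v ^ 2 ≤ κ * Hf m v * deriv (deriv (Hf m)) v := fun v => by
    rw [mul_assoc]; exact hκ' v
  have hlev := reverse_holder_between_cylinders (ρ := ρ) (CB := CB) hF2 hFa hF0 hb hBst hN heq hFc hF1c
    hNm hNi hbm hbB hH hH00 hH0 hH2 hκ1 hκ hsH hsH2 hsH' hCφ hCT hCJ0 hCJ hrk10 hr hrkhi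
  -- rewrite the integrands as powers of `u = w(F)`
  have hexp1 : ∀ p : ℝ × EuclideanSpace ℝ (Fin 3),
      ENNReal.ofReal (Hf m (F p.1 p.2)) ^ (5 / 3 : ℝ) =
        ENNReal.ofReal (w (F p.1 p.2)) ^ (4 * (10 / 9 : ℝ) ^ (k + 1)) := by
    intro p
    rw [hHw m _ hm2, ← ENNReal.ofReal_rpow_of_nonneg (hw0 _) (by rw [hm]; positivity),
      ← ENNReal.rpow_mul, hm, pow_succ]
    congr 1; ring
  have hexp2 : ∀ p : ℝ × EuclideanSpace ℝ (Fin 3),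
      ENNReal.ofReal (Hf m (F p.1 p.2)) ^ (3 / 2 : ℝ) =
        ENNReal.ofReal (w (F p.1 p.2)) ^ (4 * (10 / 9 : ℝ) ^ k) := by
    intro p
    rw [hHw m _ hm2, ← ENNReal.ofReal_rpow_of_nonneg (hw0 _) (by rw [hm]; positivity),
      ← ENNReal.rpow_mul, hm]
    congr 1; ring
  simp_rw [hexp1, hexp2] at hlev
  refine hlev.trans (mul_le_mul' ?_ le_rfl)
  -- ### the constant: `K_k ≤ (C₀ 27^k)^{10/9}`
  obtain ⟨hVc0, hVc, hVb0, hVb⟩ := volumeReal_ball_le hrk0 hrkhi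
  have harith := moser_level_constant_le k hρ (CS := CS) (Cφ := Cφ) (CB := (CB : ℝ)) hCT0 hCJ0 hV₁0
    (zero_le_one.trans hκ1) hκ2 hVc0 hVc hVb0 hVb hr₁ hr₂
  have hrhs : (((C₀ : ℝ≥0∞) * ((27 : ℝ≥0) : ℝ≥0∞) ^ k) ^ (10 / 9 : ℝ)) =
      ENNReal.ofReal (c₁' * ρ ^ (-(5 / 9 : ℝ)) * (27 : ℝ) ^ ((10 / 9 : ℝ) * k)) := by
    have h27k : ((27 : ℝ≥0) : ℝ≥0∞) ^ k = ENNReal.ofReal ((27 : ℝ) ^ k) := by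
      rw [ENNReal.ofReal_pow (by norm_num)]; norm_num
    have key : (C₀r * (27 : ℝ) ^ k) ^ (10 / 9 : ℝ) = c₁' * ρ ^ (-(5 / 9 : ℝ)) * (27 : ℝ) ^ ((10 / 9 : ℝ) * k) := by
      rw [Real.mul_rpow hC₀r0.le (by positivity), hC₀r, ← Real.rpow_mul (by positivity),
        ← Real.rpow_natCast (27 : ℝ) k, ← Real.rpow_mul (by norm_num),
        show (9 / 10 : ℝ) * (10 / 9) = 1 by norm_num, Real.rpow_one, mul_comm (k : ℝ)]
    rw [hC₀e, h27k, ← ENNReal.ofReal_mul hC₀r0.le,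
      ENNReal.ofReal_rpow_of_nonneg (by positivity) (by norm_num), key]
  rw [hrhs]
  refine ENNReal.ofReal_le_ofReal (harith.trans ?_)
  have h27 : 0 ≤ ρ ^ (-(5 / 9 : ℝ)) * (27 : ℝ) ^ ((10 / 9 : ℝ) * k) := by positivity
  calc c₁ * ρ ^ (-(5 / 9 : ℝ)) * (27 : ℝ) ^ ((10 / 9 : ℝ) * k)
      = c₁ * (ρ ^ (-(5 / 9 : ℝ)) * (27 : ℝ) ^ ((10 / 9 : ℝ) * k)) := by ring
    _ ≤ c₁' * (ρ ^ (-(5 / 9 : ℝ)) * (27 : ℝ) ^ ((10 / 9 : ℝ) * k)) :=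
        mul_le_mul_of_nonneg_right (by linarith) h27
    _ = c₁' * ρ ^ (-(5 / 9 : ℝ)) * (27 : ℝ) ^ ((10 / 9 : ℝ) * k) := by ring

end LeiZhang2011

end Literature.Analysis.FluidPDE
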